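import Summits.AnomalousDissipation.AnomalousDissipation.Theses.TaylorCertificates

/-!
# SketchCore — = Sketch.lean WITHOUT the import of the landed `Negative/CheapStatesKill.lean`
(the remote farm snapshot had not built that module at filing time: rc 75 `remote:stale:unbuilt`), so that
§1–§4 can be elaborated now; the landed kill enters §3 as an explicit hypothesis `hkill` carrying the tree
theorem's exact type. `Sketch.lean` is the primary file (imports the landed module, `example` + `Iff.rfl`).

# Sketch — crux-ideate `stmt-AnomalousDissipation-15122` (`TaylorCertificates.KolmogorovFloor`, restored),
round 1, ideator 2 (planner-cruxidea-stmt-AnomalousDissipation-15122-2-0, 2026-08-16)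

Purpose: the typed backbone of the ONE line this seat files on the restored item — the NEGATIVE line
`cheap-states-lacunary-rebase` — stated over the LANDED ν-free interface
`Theorems.KolmogorovFloor.Negative.CheapSteadyEulerStates` (Negative/CheapStatesKill.lean, in tree since
2026-08-16T06:38Z, i.e. AFTER the previous chain's cards were written).

* §0  the restored item's "kill witness in tree": `CheapSteadyEulerStates → ¬ KolmogorovFloor` BY NAME
      (one `example`, no sorry) — the composition every negative skeleton on 15122 should end in.
* §1  vocabulary copied verbatim from `Cruxes/KolmogorovFloor/SketchIdeator5.lean` (ideator 5, round 2 of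
      the 14030 chain; elaborated on the farm): `slopeSum`, `SlopeLE`, `ApproxLinearResponseWith`, `lacXi`,
      `lacE`, `cross3`, `unitVec`, `shearField`, `wienerNorm`, `QuantitativeLacunaryResponseStatement`.
* §2  `CheapAt f a η` = the five CHEAP budgets of the landed interface, and the check (`Iff.rfl`) that the
      restatement IS the landed `CheapSteadyEulerStates`.
* §3  FIRST LEMMA of the card (statement, elaborates): `CheapStatesOfLacunaryResponse` — the quantitative
      lacunary response turns into CHEAP states for EVERY smooth force (far-field bookkeeping over the landed
      `Negative/FarField.lean` + the smooth tail `f − P_L f` + the `|ξ_L|`-normalised amplitude) — and the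
      composition `kolmogorovFloor_false_of_lacunaryResponse` (PROVED logic): the two stubs of the line
      conclude `¬ KolmogorovFloor` by name.
-/

noncomputable section

set_option linter.dupNamespace false

open MeasureTheory UnitAddTorus Matrix
open scoped InnerProductSpace ENNReal BigOperators

namespace Summit.AnomalousDissipation.AnomalousDissipation.Cruxes.KolmogorovFloor.Ideate15122k2Core

open Literature.Analysis.FunctionSpaces Literature.Analysis.FluidPDE
open Summit.AnomalousDissipation.AnomalousDissipation.Theses.TaylorCertificates

local notation "𝕋³" => UnitAddTorus (Fin 3)
local notation "E³" => EuclideanSpace ℝ (Fin 3)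

/-! ## §0  The landed kill, by name -/

-- In `Sketch.lean` (imports Negative/CheapStatesKill):
--   example (h : CheapSteadyEulerStates) : ¬ KolmogorovFloor := kolmogorovFloor_false_of_CheapSteadyEulerStates h
-- Here the landed interface is RESTATED verbatim (§2, `CheapSteadyEulerStates'`) and the landed kill is the
-- hypothesis `hkill` of §3.

/-! ## §1  Vocabulary (verbatim from SketchIdeator5.lean §A, §C) -/

def slopeSum (D : ℕ) (w : 𝕋³ → E³) : ℝ :=
  ∑ k ∈ Torus.freqBall D, Real.sqrt (Torus.freqNormSq k) * ‖mFourierCoeff (EuclideanSpace.complexify ∘ w) k‖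

def SlopeLE (W : 𝕋³ → E³) (M : ℝ) : Prop :=
  ∀ k : Fin 3 → ℤ, Real.sqrt (Torus.freqNormSq k) * ‖mFourierCoeff (EuclideanSpace.complexify ∘ W) k‖ ≤ M

/-- Approximate linear response of the shear `U` to the force `f` with explicit constant `Cb`
((R1)–(R5) of DRESSED-RAY-r1-3 §1; ideator 3's object with the `∃ Cb` opened by ideator 5). -/
def ApproxLinearResponseWith (f U : 𝕋³ → E³) (Cb : ℝ) : Prop :=
  ∀ K : ℕ, 1 ≤ K → ∃ b : 𝕋³ → E³,
    Torus.IsSmooth b ∧ Torus.IsDivFree b ∧ Torus.HasZeroMean b ∧ Torus.fourierTruncate K b = b ∧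
    (∫ x, ‖b x‖ ^ 2) ≤ Cb ∧ slopeSum K b ≤ Cb * K ∧ Torus.gradNormSq b ≤ Cb * K ∧
    ∀ (D : ℕ) (W : 𝕋³ → E³) (M : ℝ), Torus.IsSmooth W → Torus.IsDivFree W → Torus.HasZeroMean W →
      Torus.fourierTruncate D W = W → SlopeLE W M →
      |∫ x, ⟪Torus.convect U b x + Torus.convect b U x - f x, W x⟫_ℝ| ≤ Cb / K * M ∧
      |∫ x, ⟪Torus.convect b b x, W x⟫_ℝ| ≤ Cb * (1 + Real.log K) * M

/-- The explicit lacunary vector `ξ_L := (L²+1, 2L(L²+1)+1, 2L(L²+1 + 2L(L²+1)+1)+1)`. -/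
def lacXi (L : ℕ) : Fin 3 → ℤ :=
  ![(L : ℤ) ^ 2 + 1, 2 * L * ((L : ℤ) ^ 2 + 1) + 1,
    2 * L * (((L : ℤ) ^ 2 + 1) + (2 * L * ((L : ℤ) ^ 2 + 1) + 1)) + 1]

/-- Integer cross product. -/
def cross3 (a b : Fin 3 → ℤ) : Fin 3 → ℤ :=
  ![a 1 * b 2 - a 2 * b 1, a 2 * b 0 - a 0 * b 2, a 0 * b 1 - a 1 * b 0]

/-- The explicit streamwise lattice direction `e_L := a·(Q,−P,0) + (R,0,−P)`. -/
def lacE (L : ℕ) : Fin 3 → ℤ :=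
  let ξ := lacXi L
  let a : ℤ := L * (ξ 0 + ξ 1 + ξ 2) * (ξ 1 + ξ 2 + 2 * ξ 0) + 1
  ![a * ξ 1 + ξ 2, -(a * ξ 0), -(ξ 0)]

/-- Real unit vector of an integer direction. -/
def unitVec (e : Fin 3 → ℤ) : E³ :=
  (Real.sqrt ((WithLp.toLp 2 fun j => (e j : ℝ) : E³) ⬝ᵥ (WithLp.toLp 2 fun j => (e j : ℝ) : E³)))⁻¹ •
    (WithLp.toLp 2 fun j => (e j : ℝ))

/-- The Kolmogorov shear of the lattice frame `(ξ, e)`: `U_{ξ,e}(x) = sin(2π ξ·x) e/|e|`. -/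
def shearField (ξ e : Fin 3 → ℤ) : 𝕋³ → E³ :=
  Torus.realTrigPoly ({ξ, -ξ} : Finset (Fin 3 → ℤ))
    (fun k => if k = ξ then (-(Complex.I / 2)) • EuclideanSpace.complexify (unitVec e)
      else (Complex.I / 2) • EuclideanSpace.complexify (unitVec e))

/-- Wiener-type size of the resolved part of a force: `Σ_{k·k ≤ L²} ‖f̂(k)‖`. -/
def wienerNorm (L : ℕ) (f : 𝕋³ → E³) : ℝ :=
  ∑ k ∈ Torus.freqBall L, ‖mFourierCoeff (EuclideanSpace.complexify ∘ f) k‖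

/-- **STUB S1 of the line (the Euler side, L-sized; ideator 5's `QuantitativeLacunaryResponseStatement`
verbatim).** Absolute `A, p` such that every solenoidal mean-zero degree-`L` force has an approximate linear
response around `U_L := shearField (lacXi L) (lacE L)` with constant `≤ A·(L·(1 + wienerNorm L f))^p`.
Content: the per-mode-line closed-form sequences (one forced mode per line in the lacunary frame; `E_m Y_m`
piecewise constant with one jump, `E_m = |k+mξ|² − |ξ|² ∈ ℤ ∖ {0}`; the two sheet constants from the closure
of the `V` parity chain, determinant `G_odd = Σ_{odd |j|≤J} 1/E_j` bounded below polynomially;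
`|X_m| ≲ 1/|m|`, `|Y_m| ≲ 1/m²`; truncation at `|m| ≤ J ≍ K/|ξ_L|`, edge residual `∝ 1/J`). -/
def QuantitativeLacunaryResponseStatement : Prop :=
  ∃ A p : ℕ, ∀ L : ℕ, 1 ≤ L →
    ∀ f : 𝕋³ → E³, Torus.IsSmooth f → Torus.IsDivFree f → Torus.HasZeroMean f →
      Torus.fourierTruncate L f = f →
      ApproxLinearResponseWith f (shearField (lacXi L) (lacE L))
        ((A : ℝ) * ((L : ℝ) * (1 + wienerNorm L f)) ^ p)

/-! ## §2  The CHEAP budgets, and the identity with the landed interface -/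

/-- The five CHEAP budgets of the landed interface for the force `f`, the state `a` and the small
parameter `η`: enstrophy and energy `≤ η^{-11/10}`, full Wiener slope `≤ η^{-3/5}` (every truncation),
work `≤ η^{2/5}`, and steady-Euler defect `≤ η·M` in the beat-dual pairing against EVERY band-limited
solenoidal mean-zero multiplier of slope `≤ M`. -/
def CheapAt (f a : 𝕋³ → E³) (η : ℝ) : Prop :=
  Torus.IsSmooth a ∧ Torus.IsDivFree a ∧ Torus.HasZeroMean a ∧
  (Torus.eGradNormSq a).toReal ≤ η ^ (-(11 / 10 : ℝ)) ∧ (∫ x, ‖a x‖ ^ 2) ≤ η ^ (-(11 / 10 : ℝ)) ∧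
  (∀ N : ℕ, ∑ κ ∈ Torus.freqBall N, Real.sqrt (Torus.freqNormSq κ) *
    ‖mFourierCoeff (EuclideanSpace.complexify ∘ a) κ‖ ≤ η ^ (-(3 / 5 : ℝ))) ∧
  |∫ x, ⟪a x, f x⟫_ℝ| ≤ η ^ (2 / 5 : ℝ) ∧
  ∀ (N : ℕ) (W : 𝕋³ → E³) (M : ℝ), Torus.IsSmooth W → Torus.IsDivFree W → Torus.HasZeroMean W →
    (∀ κ, (N : ℝ) ^ 2 < Torus.freqNormSq κ → mFourierCoeff (EuclideanSpace.complexify ∘ W) κ = 0) →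
    (∀ κ, Real.sqrt (Torus.freqNormSq κ) * ‖mFourierCoeff (EuclideanSpace.complexify ∘ W) κ‖ ≤ M) →
    |∫ x, ⟪Torus.convect a a x - f x, W x⟫_ℝ| ≤ η * M

/-- CHEAP states for every admissible force, restated through `CheapAt`. -/
def CheapSteadyEulerStates' : Prop :=
  ∀ f : 𝕋³ → E³, Torus.IsSmooth f → Torus.IsDivFree f → Torus.HasZeroMean f →
    ∃ η₀ : ℝ, 0 < η₀ ∧ ∀ η : ℝ, 0 < η → η < η₀ → ∃ a : 𝕋³ → E³, CheapAt f a η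

-- In `Sketch.lean`: `theorem cheapSteadyEulerStates'_iff : CheapSteadyEulerStates' ↔ CheapSteadyEulerStates := Iff.rfl`
-- (the restatement is the landed `Theorems.KolmogorovFloor.Negative.CheapSteadyEulerStates` verbatim).

/-! ## §3  FIRST LEMMA (statement) and the concluding composition (proved) -/

/-- **STUB S2 of the line — FIRST LEMMA of the card (M-sized bookkeeping; statement).** The quantitative
lacunary response makes CHEAP states for EVERY smooth solenoidal mean-zero force. Recipe (per `η`, with the
exponents of the landed `floor_false_of_cheapStates` and the normalisation of LACUNARY-FRAME-r2-5 §4):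
`L := ⌈η^{-σ}⌉`, `σ := 1/(100(p+1))`; split `f = P_L f + f_>` (`Σ_{k·k>L²}‖f̂(k)‖ = O(L^{-m})` for every
`m`, smoothness); `U := U_L`, `b := b_K` the response of `P_L f` with `K := ⌈2 ξ_L·ξ_L C_b/η⌉`,
`C_b ≤ A(L(1+wienerNorm L f))^p = η^{-O(σ)}`; the state is the far field of `Negative/FarField.lean`,
`a := s • U + t • b`, `s := η^{-13/25}/|ξ_L|`, `t := 1/s` (`farField_convect`: the steady-Euler defect of
`a` is the LINEAR defect of `b` plus `t²(b·∇)b`; `toReal_eGradNormSq_farField_le`,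
`integral_norm_sq_farField_le`, `slope_farField_le`, `work_farField` give the other four budgets):
enstrophy `≤ 2π²·2η^{-26/25} + 2ξ·ξ η^{26/25}C_bK ≤ η^{-11/10}`; slope `≤ η^{-13/25} + |ξ_L|η^{13/25}C_bK
≤ η^{-3/5}`; work `|(a,f)| ≤ s‖P_{>L}f̂‖_{ℓ¹} + t C_b^{1/2}‖f‖ ≤ η^{2/5}`; defect
`≤ [‖f̂_>‖_{ℓ¹} + C_b/K + t²C_b(1+log K)]·M ≤ η·M` — every `η^{-O(σ)}` loss sits against a spare power.
Why it might fail: only through a constant of S1 exponential in `L` (none is claimed: every line of the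
lacunary frame is oscillatory) — i.e. not on its own. -/
def CheapStatesOfLacunaryResponse : Prop :=
  QuantitativeLacunaryResponseStatement → CheapSteadyEulerStates'

/-- **The line concludes the crux's NEGATION by name (PROVED logic):** S1 (Euler algebra in one explicit
integer frame) + S2 (far-field bookkeeping) + the LANDED `kolmogorovFloor_false_of_CheapSteadyEulerStates`. -/
theorem kolmogorovFloor_false_of_lacunaryResponse
    (hkill : CheapSteadyEulerStates' → ¬ KolmogorovFloor)   -- = the LANDED `kolmogorovFloor_false_of_CheapSteadyEulerStates`
    (hS2 : CheapStatesOfLacunaryResponse) (hS1 : QuantitativeLacunaryResponseStatement) :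
    ¬ KolmogorovFloor :=
  hkill (hS2 hS1)

/-! ## §4  DET′ — the sheet determinant in closed form, for EVERY truncation (this seat's addition to S1)

The one load-bearing analytic stub inside S1 (Audit B: the closure of the `V` chain cannot be designed away) is
the non-vanishing of `G_odd^{(J)} := Σ_{odd |j| ≤ J} 1/E_j`, `E_j := |k + jξ|² − |ξ|² = (j²−1)ξ·ξ + 2j(k·ξ) + k·k`.
The 14030 lead recorded `|G_odd^{(J)}| ≥ K²/(12|ξ|⁴)` for `J ≥ 24|ξ|²/K²` (numerics, 20 000 samples). CLOSED FORM
(this seat; exact-rational check `toy/godd_check{,2}.py`, L = 1…5, every mode, J ∈ {1,3,11,101,1001}): for a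
lacunary frame of level `L` and `0 < k·k ≤ L²`,

    `G_odd^{(J)} ≤ −|k×ξ|² / (4 (k·ξ)² (ξ·ξ)) < 0`   for EVERY `J ≥ 1`  (no "J large" side condition),

asymptotically `G_odd^{(∞)} = −tan²∠(k,ξ)/(2ξ·ξ)·(1 + O(k·k/ξ·ξ))`. PROOF (telescoping, all finite sums):
(i) `j = ±1`: `A := 1/(k·k+2s) + 1/(k·k−2s) = −2k·k/(4s² − (k·k)²) ≤ −k·k/(2s²) = −1/(2X²) − |k×ξ|²/(2s²X²)`
(`s := k·ξ`, `X² := ξ·ξ`, lacunarity `2|s| > k·k`, Lagrange `k·k·X² = s² + |k×ξ|²`); (ii) `|j| ≥ 3`: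
`1/E_j + 1/E_{−j} = 2D_j/(D_j² − 4j²s²) ≤ 2/((j²−1)X²(1−δ))`, `D_j := (j²−1)X² + k·k`, `δ := 9k·k/(16X²)`
(Cauchy–Schwarz `s² ≤ k·k·X²`, `j²/(j²−1)² ≤ 9/64`), and `Σ_{odd 3≤j≤J} 2/(j²−1) = 1/2 − 1/(J+1) ≤ 1/2`
(TELESCOPING `1/(j−1) − 1/(j+1)`), so the positive tail is `≤ 1/(2X²(1−δ))` uniformly in `J`; (iii) hence
`G^{(J)} ≤ −|k×ξ|²/(2s²X²) + δ/(2X²(1−δ))`, and `δ/(1−δ) ≤ 2δ = 9k·k/(8X²) ≤ |k×ξ|²/(2s²)` because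
`|k×ξ|² ≥ Q²` in a lacunary frame (`crossNormSq_ge`, integer arithmetic, below) and `3k·k ≤ 3L² < 2Q`.
(The second-order identity behind the thin EXACT margin, `Σ_{odd j≥3} 2(3j²+1)/(j²−1)³ = 1/8` — with
`j = 2i+1` the summand is `(1/8)(1/i³ − 1/(i+1)³)` — is not needed once a factor 2 is conceded.) -/

/-- LACUNARY FRAME of level `L` (verbatim ideator 5). -/
def IsLacunary (L : ℕ) (ξ : Fin 3 → ℤ) : Prop :=
  (L : ℤ) ^ 2 < ξ 0 ∧ 2 * (L : ℤ) * ξ 0 < ξ 1 ∧ 2 * (L : ℤ) * (ξ 0 + ξ 1) < ξ 2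

/-- `E_j = |k + jξ|² − |ξ|²` written out. -/
def Ej (k ξ : Fin 3 → ℤ) (j : ℤ) : ℤ := (j ^ 2 - 1) * (ξ ⬝ᵥ ξ) + 2 * j * (k ⬝ᵥ ξ) + k ⬝ᵥ k

/-- The odd window `{j odd : |j| ≤ J}`. -/
def oddWindow (J : ℕ) : Finset ℤ := (Finset.Icc (-(J : ℤ)) J).filter fun j => j % 2 = 1

/-- `G_odd^{(J)} = Σ_{odd |j| ≤ J} 1/E_j` (the sheet determinant of the lacunary mode-line closure). -/
def Godd (k ξ : Fin 3 → ℤ) (J : ℕ) : ℚ := ∑ j ∈ oddWindow J, ((Ej k ξ j : ℤ) : ℚ)⁻¹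

/-- **DET′ (statement).** The sheet determinant is negative and bounded away from zero, in closed form,
for every truncation. -/
def DetBoundStatement : Prop :=
  ∀ (L : ℕ) (ξ k : Fin 3 → ℤ), IsLacunary L ξ → k ≠ 0 → k ⬝ᵥ k ≤ (L : ℤ) ^ 2 → ∀ J : ℕ,
    Godd k ξ J ≤ -(((cross3 k ξ ⬝ᵥ cross3 k ξ : ℤ) : ℚ) /
      (4 * ((k ⬝ᵥ ξ : ℤ) : ℚ) ^ 2 * ((ξ ⬝ᵥ ξ : ℤ) : ℚ)))

set_option maxHeartbeats 800000 in
/-- **Integer core of DET′ (PROVED): in a lacunary frame every mode of size `≤ L` has `|k × ξ|² ≥ Q²`.**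
Cases: `k₀ ≠ 0` ⇒ `|k₂P − k₀R| ≥ R − LP > Q`; `k₀ = 0 ≠ k₁` ⇒ `|k₁R − k₂Q| ≥ R − LQ > Q`;
`k₀ = k₁ = 0 ≠ k₂` ⇒ `|k×ξ|² = k₂²(Q² + P²) ≥ Q²`. -/
theorem crossNormSq_ge {L : ℕ} {ξ k : Fin 3 → ℤ} (hξ : IsLacunary L ξ)
    (hk : k ≠ 0) (hkL : k ⬝ᵥ k ≤ (L : ℤ) ^ 2) : ξ 1 ^ 2 ≤ cross3 k ξ ⬝ᵥ cross3 k ξ := by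
  obtain ⟨h0, h1, h2⟩ := hξ
  have hcc : cross3 k ξ ⬝ᵥ cross3 k ξ =
      (k 1 * ξ 2 - k 2 * ξ 1) * (k 1 * ξ 2 - k 2 * ξ 1) + (k 2 * ξ 0 - k 0 * ξ 2) * (k 2 * ξ 0 - k 0 * ξ 2) +
        (k 0 * ξ 1 - k 1 * ξ 0) * (k 0 * ξ 1 - k 1 * ξ 0) := by
    simp [cross3, dotProduct, Fin.sum_univ_three]
  have hkk : k ⬝ᵥ k = k 0 * k 0 + k 1 * k 1 + k 2 * k 2 := by
    simp [dotProduct, Fin.sum_univ_three]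
  have hL : (0 : ℤ) ≤ L := by positivity
  have hP : 0 < ξ 0 := lt_of_le_of_lt (by positivity) h0
  have hQ : 0 < ξ 1 := by nlinarith
  have hR : 0 < ξ 2 := by nlinarith
  rw [hkk] at hkL
  have hb0 : k 0 * k 0 ≤ (L : ℤ) ^ 2 := by nlinarith [mul_self_nonneg (k 1), mul_self_nonneg (k 2)]
  have hb2 : k 2 * k 2 ≤ (L : ℤ) ^ 2 := by nlinarith [mul_self_nonneg (k 0), mul_self_nonneg (k 1)]
  have hb1 : k 1 * k 1 ≤ (L : ℤ) ^ 2 := by nlinarith [mul_self_nonneg (k 0), mul_self_nonneg (k 2)]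
  have ha0 : |k 0| ≤ L := abs_le_of_sq_le_sq (by nlinarith [hb0]) hL
  have ha1 : |k 1| ≤ L := abs_le_of_sq_le_sq (by nlinarith [hb1]) hL
  have ha2 : |k 2| ≤ L := abs_le_of_sq_le_sq (by nlinarith [hb2]) hL
  have hsq1 : 0 ≤ (k 1 * ξ 2 - k 2 * ξ 1) * (k 1 * ξ 2 - k 2 * ξ 1) := mul_self_nonneg _
  have hsq2 : 0 ≤ (k 2 * ξ 0 - k 0 * ξ 2) * (k 2 * ξ 0 - k 0 * ξ 2) := mul_self_nonneg _
  have hsq3 : 0 ≤ (k 0 * ξ 1 - k 1 * ξ 0) * (k 0 * ξ 1 - k 1 * ξ 0) := mul_self_nonneg _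
  -- the bound `|k₂| ξ₀ ≤ L ξ₀`, `|k₂| ξ₁ ≤ L ξ₁` and `2L(ξ₀+ξ₁) < ξ₂`
  have e20 : |k 2| * ξ 0 ≤ L * ξ 0 := mul_le_mul_of_nonneg_right ha2 hP.le
  have e21 : |k 2| * ξ 1 ≤ L * ξ 1 := mul_le_mul_of_nonneg_right ha2 hQ.le
  rw [hcc, sq]
  by_cases hk0 : k 0 = 0
  · by_cases hk1 : k 1 = 0
    · -- k = (0,0,k₂), k₂ ≠ 0: the first component is −k₂ ξ₁
      have hk2 : k 2 ≠ 0 := by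
        intro h; apply hk; ext i; fin_cases i <;> simp [h, hk0, hk1]
      have h1le : 1 ≤ |k 2| := Int.one_le_abs hk2
      have hkk2 : 1 ≤ k 2 * k 2 := by
        have h := mul_le_mul h1le h1le zero_le_one (abs_nonneg _)
        rw [one_mul, abs_mul_abs_self] at h
        exact h
      have hc2 : ξ 1 * ξ 1 ≤ (k 1 * ξ 2 - k 2 * ξ 1) * (k 1 * ξ 2 - k 2 * ξ 1) := by
        have hrw : (k 1 * ξ 2 - k 2 * ξ 1) * (k 1 * ξ 2 - k 2 * ξ 1) = (k 2 * k 2) * (ξ 1 * ξ 1) := by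
          rw [hk1]; ring
        rw [hrw]
        nlinarith [hkk2, mul_self_nonneg (ξ 1)]
      linarith [hc2, hsq2, hsq3]
    · -- k₀ = 0 ≠ k₁: first component |k₁ξ₂ − k₂ξ₁| ≥ ξ₂ − Lξ₁ ≥ ξ₁
      have h1le : 1 ≤ |k 1| := Int.one_le_abs hk1
      have hL1 : (1 : ℤ) ≤ L := le_trans h1le ha1
      have hlow : |k 1| * ξ 2 - |k 2| * ξ 1 ≤ |k 1 * ξ 2 - k 2 * ξ 1| := by
        have h := abs_sub_abs_le_abs_sub (k 1 * ξ 2) (k 2 * ξ 1)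
        rw [abs_mul, abs_mul, abs_of_pos hR, abs_of_pos hQ] at h
        exact h
      have e1 : ξ 2 ≤ |k 1| * ξ 2 := by nlinarith [h1le, hR.le]
      have e3 : ξ 1 ≤ (L : ℤ) * ξ 1 := by nlinarith [hL1, hQ.le]
      have e4 : 2 * (L : ℤ) * ξ 1 ≤ 2 * (L : ℤ) * (ξ 0 + ξ 1) := by nlinarith [hL, hP.le]
      have hc : ξ 1 ≤ |k 1 * ξ 2 - k 2 * ξ 1| := by linarith [hlow, e1, e21, e3, e4, h2]
      have hc2 : ξ 1 * ξ 1 ≤ (k 1 * ξ 2 - k 2 * ξ 1) * (k 1 * ξ 2 - k 2 * ξ 1) := by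
        have h := mul_le_mul hc hc hQ.le (abs_nonneg _)
        rw [abs_mul_abs_self] at h
        exact h
      linarith [hc2, hsq2, hsq3]
  · -- k₀ ≠ 0: second component |k₂ξ₀ − k₀ξ₂| ≥ ξ₂ − Lξ₀ ≥ ξ₁
    have h1le : 1 ≤ |k 0| := Int.one_le_abs hk0
    have hL1 : (1 : ℤ) ≤ L := le_trans h1le ha0
    have hlow : |k 0| * ξ 2 - |k 2| * ξ 0 ≤ |k 2 * ξ 0 - k 0 * ξ 2| := by
      have h := abs_sub_abs_le_abs_sub (k 0 * ξ 2) (k 2 * ξ 0)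
      rw [abs_mul, abs_mul, abs_of_pos hR, abs_of_pos hP, abs_sub_comm] at h
      exact h
    have e1 : ξ 2 ≤ |k 0| * ξ 2 := by nlinarith [h1le, hR.le]
    have e3 : ξ 1 ≤ (L : ℤ) * ξ 1 := by nlinarith [hL1, hQ.le]
    have e5 : 0 ≤ (L : ℤ) * ξ 0 := by nlinarith [hL, hP.le]
    have hc : ξ 1 ≤ |k 2 * ξ 0 - k 0 * ξ 2| := by nlinarith [hlow, e1, e20, e3, e5, h2]
    have hc2 : ξ 1 * ξ 1 ≤ (k 2 * ξ 0 - k 0 * ξ 2) * (k 2 * ξ 0 - k 0 * ξ 2) := by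
      have h := mul_le_mul hc hc hQ.le (abs_nonneg _)
      rw [abs_mul_abs_self] at h
      exact h
    linarith [hc2, hsq1, hsq3]

end Summit.AnomalousDissipation.AnomalousDissipation.Cruxes.KolmogorovFloor.Ideate15122k2Core
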